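import Literature.Analysis.SpecialFunctions.LegendreGeneratingBound
import Literature.Analysis.SpecialFunctions.AssociatedLegendreHilbertBasis
import HarnessLib

/-!
# The `L² → L^∞` Nikolskii inequality for polynomials on `[-1, 1]` and the sup bound for the
# normalised associated Legendre functions

Topic `Literature/Analysis/SpecialFunctions`. Three classical facts:

* `legendre_eval_eq_gegenbauerSum` — the Rodrigues Legendre polynomials of the tree coincide with
  `C_n^{(1/2)}` (both satisfy Bonnet's recursion with `P_0 = 1`, `P_1 = x`), whence
  **`|P_n(x)| ≤ 1` on `[-1, 1]`** (`abs_eval_legendre_le_one`) from `abs_gegenbauerSum_half_le_one`;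
* **Nikolskii's inequality** `Q(x)² ≤ ((N+1)²/2) ∫_{-1}^1 Q²` for `deg Q ≤ N`, `x ∈ [-1, 1]`
  (`sq_eval_le_of_natDegree_le`: expand in the orthogonal `P_j`, `‖P_j‖² = 2/(2j+1)`,
  Cauchy–Schwarz),
  and its consequence for nonnegative polynomials, `G(x) ≤ ((N+1)²/2) ∫_{-1}^1 G`
  (`eval_le_of_nonneg`);
* **the sup bound for the normalised associated Legendre functions**
  `|ẽ^m_k(x)|² = c_{m,k}² (1-x²)^m q_{m,k}(x)² ≤ (2(m+k)+1)²/2` on `[-1, 1]`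
  (`sq_assocLegFn_le`), the
  pointwise input for the smoothness of expansions in spherical / oblate spheroidal harmonics
  (Dafermos–Rodnianski–Shlapentokh-Rothman, arXiv:1402.7034, §5.2.1).

## References

* G. E. Andrews, R. Askey, R. Roy, *Special Functions* (1999), (6.4.11), §2.5. [AndrewsAskeyRoy1999]
* M. Dafermos, I. Rodnianski, Y. Shlapentokh-Rothman, arXiv:1402.7034, §5.2.1.
  [DafermosRodnianskiShlapentokhrothman2014]
-/

noncomputable section

open Finset Polynomial MeasureTheory Set intervalIntegral
open scoped Nat

namespace Literature.Analysis.SpecialFunctions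

/-! ### `P_n = C_n^{(1/2)}` and `|P_n| ≤ 1` -/

/-- **The Rodrigues Legendre polynomials are the Gegenbauer polynomials `C_n^{(1/2)}`.**
[cite: AndrewsAskeyRoy1999, §6.4] -/
theorem legendre_eval_eq_gegenbauerSum (n : ℕ) (s : ℝ) :
    (legendre n).eval s = gegenbauerSum (1 / 2) n s := by
  induction n using Nat.twoStepInduction with
  | zero => rw [legendre_zero, eval_one, gegenbauerSum_zero]
  | one => rw [legendre_one, eval_X, gegenbauerSum_one]; ring
  | more n ih0 ih1 =>
    have hB := congrArg (fun p : ℝ[X] ↦ p.eval s) (legendre_succ_succ n)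
    simp only [eval_mul, eval_sub, eval_C, eval_X] at hB
    have hG := gegenbauerSum_rec (1 / 2) n s
    rw [ih0, ih1] at hB
    have hn : (n : ℝ) + 2 ≠ 0 := by positivity
    apply mul_left_cancel₀ hn
    linear_combination hB - hG

/-- **`|P_n(x)| ≤ 1` for `|x| ≤ 1`.** [cite: AndrewsAskeyRoy1999, (6.4.11)] -/
theorem abs_eval_legendre_le_one (n : ℕ) {s : ℝ} (hs : |s| ≤ 1) : |(legendre n).eval s| ≤ 1 := by
  rw [legendre_eval_eq_gegenbauerSum]
  exact abs_gegenbauerSum_half_le_one n hs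

/-! ### Nikolskii's inequality -/

/-- `∫_{-1}^1 P_j P_k = δ_{jk} 2/(2j+1)`. [cite: AndrewsAskeyRoy1999, (2.5.14)] -/
theorem integral_legendre_mul_legendre (j k : ℕ) :
    ∫ x in (-1 : ℝ)..1, (legendre j).eval x * (legendre k).eval x =
      if j = k then (2 : ℝ) / (2 * j + 1) else 0 := by
  split_ifs with h
  · subst h
    simp_rw [← sq]
    exact integral_legendre_sq j
  · rcases lt_or_gt_of_ne h with h | h
    · simp_rw [mul_comm ((legendre j).eval _)]
      exact integral_legendre_mul_legendre_eq_zero h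
    · exact integral_legendre_mul_legendre_eq_zero h

/-- The squared `L²` norm of a Legendre combination: `∫ (Σ α_j P_j)² = Σ α_j² · 2/(2j+1)`.
[cite: AndrewsAskeyRoy1999, §2.5] -/
theorem integral_sq_sum_legendre (N : ℕ) (α : ℕ → ℝ) :
    ∫ x in (-1 : ℝ)..1, (∑ j ∈ range (N + 1), C (α j) * legendre j).eval x ^ 2 =
      ∑ j ∈ range (N + 1), α j ^ 2 * (2 / (2 * j + 1)) := by
  have hint : ∀ j k, IntervalIntegrable
      (fun x ↦ α j * (legendre j).eval x * (α k * (legendre k).eval x)) volume (-1) 1 :=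
    fun j k ↦ Continuous.intervalIntegrable (by fun_prop) _ _
  have hexp : ∀ x, (∑ j ∈ range (N + 1), C (α j) * legendre j).eval x ^ 2 =
      ∑ j ∈ range (N + 1), ∑ k ∈ range (N + 1),
        α j * (legendre j).eval x * (α k * (legendre k).eval x) := by
    intro x
    rw [eval_finsetSum, sq, sum_mul_sum]
    refine sum_congr rfl fun j _ ↦ sum_congr rfl fun k _ ↦ ?_
    rw [eval_mul, eval_C, eval_mul, eval_C]
  simp_rw [hexp]
  rw [intervalIntegral.integral_finsetSum (fun j _ ↦
    Continuous.intervalIntegrable (by fun_prop) _ _)]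
  refine sum_congr rfl fun j hj ↦ ?_
  rw [intervalIntegral.integral_finsetSum (fun k _ ↦ hint j k)]
  have hterm : ∀ k ∈ range (N + 1), ∫ x in (-1 : ℝ)..1,
      α j * (legendre j).eval x * (α k * (legendre k).eval x) =
      α j * α k * if j = k then (2 : ℝ) / (2 * j + 1) else 0 := by
    intro k _
    rw [← integral_legendre_mul_legendre, ← intervalIntegral.integral_const_mul]
    refine intervalIntegral.integral_congr fun x _ ↦ ?_
    ring
  rw [sum_congr rfl hterm]
  simp_rw [mul_ite, mul_zero]
  rw [sum_ite_eq, if_pos hj]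
  ring

/-- `Σ_{j ≤ N} (2j+1)/2 = (N+1)²/2`. [folklore] -/
theorem sum_range_two_mul_add_one_div (N : ℕ) :
    ∑ j ∈ range (N + 1), ((2 * (j : ℝ) + 1) / 2) = ((N : ℝ) + 1) ^ 2 / 2 := by
  induction N with
  | zero => simp
  | succ n ih =>
    rw [sum_range_succ, ih]
    push_cast
    ring

/-- **Nikolskii's inequality** (`L² → L^∞` for polynomials on `[-1,1]`): for `deg Q ≤ N` and
`x ∈ [-1, 1]`, `Q(x)² ≤ ((N+1)²/2) ∫_{-1}^1 Q²`. [cite: AndrewsAskeyRoy1999, §2.5] -/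
theorem sq_eval_le_of_natDegree_le {N : ℕ} {Q : ℝ[X]} (hQ : Q.natDegree ≤ N) {x : ℝ}
    (hx : x ∈ Icc (-1 : ℝ) 1) :
    Q.eval x ^ 2 ≤ ((N : ℝ) + 1) ^ 2 / 2 * ∫ t in (-1 : ℝ)..1, Q.eval t ^ 2 := by
  obtain ⟨α, hα⟩ := exists_eq_sum_C_mul_legendre N Q hQ
  have hxabs : |x| ≤ 1 := abs_le.2 ⟨hx.1, hx.2⟩
  -- `|Q(x)| ≤ Σ |α_j|`
  have h1 : |Q.eval x| ≤ ∑ j ∈ range (N + 1), |α j| := by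
    rw [hα, eval_finsetSum]
    refine (abs_sum_le_sum_abs _ _).trans (sum_le_sum fun j _ ↦ ?_)
    rw [eval_mul, eval_C, abs_mul]
    exact (mul_le_mul_of_nonneg_left (abs_eval_legendre_le_one j hxabs) (abs_nonneg _)).trans
      (mul_one _).le
  -- Cauchy–Schwarz with weights `(2j+1)/2`
  have h2 : (∑ j ∈ range (N + 1), |α j|) ^ 2 ≤
      (∑ j ∈ range (N + 1), α j ^ 2 * (2 / (2 * j + 1))) *
        ∑ j ∈ range (N + 1), ((2 * (j : ℝ) + 1) / 2) := by
    have h := sum_mul_sq_le_sq_mul_sq (range (N + 1))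
      (fun j ↦ |α j| * Real.sqrt (2 / (2 * j + 1))) (fun j ↦ Real.sqrt ((2 * (j : ℝ) + 1) / 2))
    have hprod : ∀ j ∈ range (N + 1),
        |α j| * Real.sqrt (2 / (2 * j + 1)) * Real.sqrt ((2 * (j : ℝ) + 1) / 2) = |α j| := by
      intro j _
      have hpos : (0 : ℝ) < 2 * j + 1 := by positivity
      rw [mul_assoc, ← Real.sqrt_mul (by positivity),
        show (2 : ℝ) / (2 * j + 1) * ((2 * j + 1) / 2) = 1 by field_simp, Real.sqrt_one, mul_one]
    rw [sum_congr rfl hprod] at h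
    have hsq1 : ∀ j ∈ range (N + 1), (|α j| * Real.sqrt (2 / (2 * j + 1))) ^ 2 =
        α j ^ 2 * (2 / (2 * j + 1)) := by
      intro j _
      rw [mul_pow, sq_abs, Real.sq_sqrt (by positivity)]
    have hsq2 : ∀ j ∈ range (N + 1),
        Real.sqrt ((2 * (j : ℝ) + 1) / 2) ^ 2 = (2 * (j : ℝ) + 1) / 2 := by
      intro j _
      rw [Real.sq_sqrt (by positivity)]
    rwa [sum_congr rfl hsq1, sum_congr rfl hsq2] at h
  rw [sum_range_two_mul_add_one_div, ← integral_sq_sum_legendre, ← hα] at h2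
  calc Q.eval x ^ 2 = |Q.eval x| ^ 2 := (sq_abs _).symm
    _ ≤ (∑ j ∈ range (N + 1), |α j|) ^ 2 :=
        pow_le_pow_left₀ (abs_nonneg _) h1 2
    _ ≤ (∫ t in (-1 : ℝ)..1, Q.eval t ^ 2) * (((N : ℝ) + 1) ^ 2 / 2) := h2
    _ = ((N : ℝ) + 1) ^ 2 / 2 * ∫ t in (-1 : ℝ)..1, Q.eval t ^ 2 := mul_comm _ _

/-- **Nikolskii for nonnegative polynomials**: if `G ≥ 0` on `[-1, 1]` and `deg G ≤ N` then
`G(x) ≤ ((N+1)²/2) ∫_{-1}^1 G` on `[-1, 1]`. [cite: AndrewsAskeyRoy1999, §2.5] -/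
theorem eval_le_of_nonneg {N : ℕ} {G : ℝ[X]} (hG : G.natDegree ≤ N)
    (hnn : ∀ t ∈ Icc (-1 : ℝ) 1, 0 ≤ G.eval t) {x : ℝ} (hx : x ∈ Icc (-1 : ℝ) 1) :
    G.eval x ≤ ((N : ℝ) + 1) ^ 2 / 2 * ∫ t in (-1 : ℝ)..1, G.eval t := by
  -- the maximum `M` of `G` on `[-1, 1]`
  obtain ⟨x₀, hx₀, hmax⟩ := isCompact_Icc.exists_isMaxOn (nonempty_Icc.2 (by norm_num))
    (G.continuous.continuousOn (s := Icc (-1 : ℝ) 1))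
  set M := G.eval x₀ with hM
  have hM0 : 0 ≤ M := hnn x₀ hx₀
  have hGM : ∀ t ∈ Icc (-1 : ℝ) 1, G.eval t ≤ M := fun t ht ↦ hmax ht
  -- `M² ≤ ((N+1)²/2) ∫ G² ≤ ((N+1)²/2) M ∫ G`
  have h1 := sq_eval_le_of_natDegree_le hG hx₀
  have h2 : ∫ t in (-1 : ℝ)..1, G.eval t ^ 2 ≤ ∫ t in (-1 : ℝ)..1, M * G.eval t := by
    refine intervalIntegral.integral_mono_on (by norm_num)
      (Continuous.intervalIntegrable (by fun_prop) _ _)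
      (Continuous.intervalIntegrable (by fun_prop) _ _) fun t ht ↦ ?_
    rw [sq]
    exact mul_le_mul_of_nonneg_right (hGM t ht) (hnn t ht)
  rw [intervalIntegral.integral_const_mul] at h2
  have hI0 : 0 ≤ ∫ t in (-1 : ℝ)..1, G.eval t :=
    intervalIntegral.integral_nonneg (by norm_num) fun t ht ↦ hnn t ht
  have hK0 : 0 ≤ ((N : ℝ) + 1) ^ 2 / 2 := by positivity
  -- conclude `M ≤ K ∫ G`
  have hMle : M ≤ ((N : ℝ) + 1) ^ 2 / 2 * ∫ t in (-1 : ℝ)..1, G.eval t := by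
    by_cases hM0' : M = 0
    · rw [hM0']; positivity
    · have hMpos : 0 < M := lt_of_le_of_ne hM0 (Ne.symm hM0')
      have h3 : M ^ 2 ≤ ((N : ℝ) + 1) ^ 2 / 2 * (M * ∫ t in (-1 : ℝ)..1, G.eval t) :=
        h1.trans (mul_le_mul_of_nonneg_left h2 hK0)
      have h4 : M * M ≤ M * (((N : ℝ) + 1) ^ 2 / 2 * ∫ t in (-1 : ℝ)..1, G.eval t) := by
        rw [← sq]; linarith
      exact le_of_mul_le_mul_left h4 hMpos
  exact (hGM x hx).trans hMle

/-! ### The sup bound for the normalised associated Legendre functions -/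

/-- The square of `ẽ^m_k` is the polynomial `c² (1-x²)^m q²` on `[-1, 1]`. [folklore] -/
theorem sq_assocLeg_eq_eval (m k : ℕ) {x : ℝ} (hx : x ∈ Icc (-1 : ℝ) 1) :
    (assocLegNormConst m k * (assocLegHalfWeight m x * (assocLegPoly m k).eval x)) ^ 2 =
      (C (assocLegNormConst m k ^ 2) * (assocLegWeight m * (assocLegPoly m k) ^ 2)).eval x := by
  rw [eval_mul, eval_C, eval_mul, eval_pow, mul_pow, mul_pow, sq (assocLegHalfWeight m x),
    assocLegHalfWeight_sq m hx]

/-- The degree of `c² (1-x²)^m q²` is `≤ 2(m+k)`. [folklore] -/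
theorem natDegree_sqPoly_le (m k : ℕ) :
    (C (assocLegNormConst m k ^ 2) * (assocLegWeight m * (assocLegPoly m k) ^ 2)).natDegree ≤
      2 * (m + k) := by
  refine (natDegree_C_mul_le _ _).trans ?_
  refine natDegree_mul_le.trans ?_
  have h1 : (assocLegWeight m).natDegree ≤ 2 * m := by
    rw [assocLegWeight]
    refine natDegree_pow_le.trans ?_
    have : (1 - X ^ 2 : ℝ[X]).natDegree ≤ 2 := by
      refine (natDegree_sub_le _ _).trans ?_
      rw [natDegree_one, natDegree_X_pow]; 
      simp
    calc m * (1 - X ^ 2 : ℝ[X]).natDegree ≤ m * 2 := Nat.mul_le_mul_left m this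
      _ = 2 * m := by ring
  have h2 : ((assocLegPoly m k) ^ 2).natDegree ≤ 2 * k := by
    refine natDegree_pow_le.trans ?_
    rw [natDegree_assocLegPoly]
  omega

/-- `∫_{-1}^1 c² (1-x²)^m q² = 1` (normalisation of `ẽ^m_k`). [folklore] -/
theorem integral_sqPoly (m k : ℕ) :
    ∫ t in (-1 : ℝ)..1,
      (C (assocLegNormConst m k ^ 2) * (assocLegWeight m * (assocLegPoly m k) ^ 2)).eval t = 1 := by
  have h := assocLegNormConst_sq_mul m k
  rw [assocLegForm_eq_integral, ← intervalIntegral.integral_const_mul] at h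
  refine Eq.trans (intervalIntegral.integral_congr fun t _ ↦ ?_) h
  simp only [eval_mul, eval_C, eval_pow]
  ring

/-- **Sup bound for the normalised associated Legendre functions**: on `[-1, 1]`,
`|ẽ^m_k(x)|² = c_{m,k}² (1-x²)^m q_{m,k}(x)² ≤ (2(m+k)+1)²/2`.
[cite: DafermosRodnianskiShlapentokhrothman2014, §5.2.1] -/
theorem sq_assocLegFn_le (m k : ℕ) {x : ℝ} (hx : x ∈ Icc (-1 : ℝ) 1) :
    (assocLegNormConst m k * (assocLegHalfWeight m x * (assocLegPoly m k).eval x)) ^ 2 ≤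
      (2 * ((m : ℝ) + k) + 1) ^ 2 / 2 := by
  rw [sq_assocLeg_eq_eval m k hx]
  have hnn : ∀ t ∈ Icc (-1 : ℝ) 1,
      0 ≤ (C (assocLegNormConst m k ^ 2) * (assocLegWeight m * (assocLegPoly m k) ^ 2)).eval t :=
    fun t ht ↦ by rw [← sq_assocLeg_eq_eval m k ht]; exact sq_nonneg _
  have h := eval_le_of_nonneg (natDegree_sqPoly_le m k) hnn hx
  rw [integral_sqPoly, mul_one] at h
  refine h.trans_eq ?_
  push_cast
  ring

end Literature.Analysis.SpecialFunctions
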